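import Literature.Geometry.Symplectic.JSphereFamilyLeafFunction
import Literature.Geometry.Symplectic.SphereIntersectionIndexHomologicalNoncompact
import Literature.Geometry.Symplectic.PositivityOfIntersectionsLocalProofs
import Literature.Geometry.Symplectic.JHolomorphicLocalIntersectionsProofs
import HarnessLib

/-!
# The uniqueness clause of the Hofer–Lizan–Sikorav local foliation by embedded `J`-spheres

C. Wendl, *Holomorphic Curves in Low Dimensions*, LNM 2216 (2018), **Prop. 2.53** (case
`m = [u] · [u] = 0`) with **Thm. 2.49** (positivity of intersections): the named fact
`Literature.Geometry.Symplectic.hls_localFoliation_embeddedSphere_trivialNormal`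
(`JSphereLocalFoliation.lean`) records, for an embedded `JX`-holomorphic two-chart sphere
`S = (u₀, v₀)` with trivial normal bundle in an almost complex 4-manifold `(X, JX)`, the EXISTENCE
of a jointly smooth family `(U a, V a)`, `|a| < ε`, of pairwise disjoint embedded `JX`-spheres
through `S = (U 0, V 0)` sweeping out an open neighbourhood with injective differentials, AND the
UNIQUENESS clause: every `JX`-two-chart sphere `(u, v)` whose glued map `F : ℂℙ¹ → X` is homotopic
to that of `S` and whose image meets the swept set has the image of a leaf.

This file PROVES the uniqueness clause from the existence data, following the printed argument
(Wendl 2018, proof of Prop. 2.53, last paragraph, and Thm. 2.49): this is the step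
"`[v] · [w] = [u] · [u] = 0`, so by positivity of intersections two such curves are either
identical or disjoint". In the tree's vocabulary the ingredients are

* the LEAF FUNCTION `leafFunction U V ε : X → ℂ` of the family and its leaf-coordinate package
  `exists_leafCoordinateAt` (`JSphereFamilyLeafFunction.lean`): every leaf `{A = a}` is, near each
  of its points, the zero set of a smooth submersion with complex-linear differential along the
  leaf, after the real-linear correction `α (A - a) + β conj (A - a)` of
  `LeafCoordinateComplexLinearisation.lean`, the sign `|β| < |α|` versus `|α| < |β|` being
  CONSTANT on the (connected) swept set (`leafFunction_sign_const`);
* POSITIVITY OF INTERSECTIONS in the leaf-coordinate form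
  `positivityOfIntersections_leafCoordinate_holds` (`PositivityOfIntersectionsLocalProofs.lean`;
  Wendl Thm. 2.49, McDuff 1991 Thm. 1.1): an isolated crossing of a `JX`-curve with a leaf has
  winding number `≥ 1` in the complex-linear leaf coordinate, hence (`wind_mul_add_mul_conj_of_norm_lt`)
  `≥ 1` for ALL crossings or `≤ -1` for ALL crossings in the plain coordinate `A - a`
  (`wind_leafFunction_of_crossing`);
* the INTERSECTION NUMBER IS HOMOLOGICAL: `sphere_zeroSetIndex_factorsThroughHomology_of_isClosed`
  (`SphereIntersectionIndexHomologicalNoncompact.lean`; Bredon 1993, VI.11): the sum of the crossing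
  indices of a smooth two-chart sphere with the closed surface `{A = a}` is `c (F_*[ℂℙ¹])` for an
  additive `c` on `H₂(X; ℤ)`, hence the same for the homotopic central leaf `F₀`, which misses the
  leaf `a ≠ 0` — so it is `0`, and finitely many crossings are impossible unless there are none
  (`not_finite_crossings`);
* the IDENTICAL-OR-FINITE dichotomy for a `JX`-sphere against an embedded `JX`-sphere,
  `twoChart_preimage_eq_univ_or_finite` / `twoChart_range_union_eq_of_forall_mem`
  (`JSphereMeetsEmbeddedJSphere.lean`; McDuff 1991 Lemma 2.3 unique continuation,
  `jHolomorphic_uniqueContinuation_const_holds`).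

Main result: `hls_uniqueness_of_localFamily`. Relative to the last clause of
`hls_localFoliation_embeddedSphere_trivialNormal` it carries ONE extra hypothesis, the
non-constancy `∃ z, u z ≠ u 0` of the test sphere; in the printed proof this is supplied by
`c₁([F]) = c₁([S]) = 2 ≠ 0` (adjunction, Wendl (2.13)), which is not available in the tree.
-- TODO(general form): the existence half of Prop. 2.53 (automatic transversality Thm. 2.44/2.46,
-- implicit function theorem Thm. 2.11 for the normal Cauchy–Riemann operator) and the
-- `c₁`-non-constancy of spheres homotopic to an embedded `J`-sphere are not proved here.

## References

* C. Wendl, *Holomorphic Curves in Low Dimensions*, Lecture Notes in Math. 2216, Springer (2018),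
  Prop. 2.53 and its proof, Thm. 2.49. [Wendl2018]
* D. McDuff, *The local behaviour of holomorphic curves in almost complex 4-manifolds*,
  J. Differential Geom. 34 (1991) 143–164, Lemma 2.3, Thm. 1.1. [McDuff1991LocalBehaviour]
* G. E. Bredon, *Topology and Geometry*, GTM 139, Springer (1993), VI.11. [Bredon1993]
* H. Hofer, V. Lizan, J.-C. Sikorav, J. Geom. Anal. 7 (1997) 149–159, Thm. 1. [HoferLizanSikorav1997]
-/

noncomputable section

open scoped Manifold ContDiff Topology ComplexConjugate
open Set Function Metric Filter Complex Literature.Geometry.Manifold Literature.Topology.PlaneTopology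

namespace Literature.Geometry.Symplectic


/-! ### Assembly: the uniqueness clause from the family (Wendl 2018, Prop. 2.53 with Thm. 2.49) -/

section Assembly

open Literature.Topology.FourManifolds Literature.Topology.FourManifolds.ComplexProjectiveSpace
  Literature.AlgebraicTopology.SingularHomology

variable {X : Type} [TopologicalSpace X] [T2Space X] [SecondCountableTopology X]
  [ChartedSpace (EuclideanSpace ℝ (Fin 4)) X] [IsManifold (𝓡 4) ∞ X]
  {JX : AlmostComplexStructure (𝓡 4) ∞ X} {ε : ℝ} {U V : ℂ → ℂ → X}

/-- A finite subset of `ℂ` is not a neighbourhood of any point. [folklore] -/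
theorem not_eventually_mem_of_finite {S : Set ℂ} (hS : S.Finite) (z : ℂ) :
    ¬ ∀ᶠ z' in 𝓝 z, z' ∈ S := by
  intro h
  have h1 : ∀ᶠ z' in 𝓝[≠] z, z' ∈ S := h.filter_mono nhdsWithin_le_nhds
  have hcl : IsClosed (S \ {z}) := (hS.subset fun x hx => hx.1).isClosed
  have h2 : ∀ᶠ z' in 𝓝[≠] z, z' ∉ S \ {z} := by
    have hm : (S \ {z})ᶜ ∈ 𝓝 z := hcl.isOpen_compl.mem_nhds (fun h' => h'.2 rfl)
    exact Filter.Eventually.filter_mono nhdsWithin_le_nhds hm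
  obtain ⟨z', ⟨hz'S, hz'n⟩, hz'ne⟩ := ((h1.and h2).and self_mem_nhdsWithin).exists
  exact hz'n ⟨hz'S, hz'ne⟩

/-- The circle of radius `r` about `z` is the translate of the circle about `0`. [folklore] -/
theorem circleLoop_zero_add (z : ℂ) (r t : ℝ) : circleLoop 0 r t + z = circleLoop z r t := by
  have h := circleLoop_sub z z r t
  rw [sub_self] at h
  rw [← h, sub_add_cancel]

variable (hε : 0 < ε)
  (hleaf : ∀ a : ℂ, ‖a‖ < ε →
    ContMDiff 𝓘(ℝ, ℂ) (𝓡 4) ∞ (U a) ∧ ContMDiff 𝓘(ℝ, ℂ) (𝓡 4) ∞ (V a) ∧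
    (∀ z : ℂ, z ≠ 0 → V a z = U a z⁻¹) ∧
    IsJHolomorphic (𝓡 4) (fun y => JX y) (U a) ∧ IsJHolomorphic (𝓡 4) (fun y => JX y) (V a) ∧
    Injective (U a) ∧ (∀ z, Injective (mfderiv 𝓘(ℝ, ℂ) (𝓡 4) (U a) z)) ∧
    Injective (mfderiv 𝓘(ℝ, ℂ) (𝓡 4) (V a) 0) ∧ V a 0 ∉ range (U a))
  (hUs : ContMDiffOn 𝓘(ℝ, ℂ × ℂ) (𝓡 4) ∞ (fun q : ℂ × ℂ => U q.1 q.2) (ball 0 ε ×ˢ univ))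
  (hVs : ContMDiffOn 𝓘(ℝ, ℂ × ℂ) (𝓡 4) ∞ (fun q : ℂ × ℂ => V q.1 q.2) (ball 0 ε ×ˢ univ))
  (hdisj : ∀ a a' : ℂ, ‖a‖ < ε → ‖a'‖ < ε → a ≠ a' →
    Disjoint (range (U a) ∪ {V a 0}) (range (U a') ∪ {V a' 0}))
  (himm : ∀ q ∈ ball (0 : ℂ) ε ×ˢ (univ : Set ℂ),
    Injective (mfderiv 𝓘(ℝ, ℂ × ℂ) (𝓡 4) (fun q : ℂ × ℂ => U q.1 q.2) q) ∧
    Injective (mfderiv 𝓘(ℝ, ℂ × ℂ) (𝓡 4) (fun q : ℂ × ℂ => V q.1 q.2) q))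

include hε hleaf hdisj hUs hVs himm in
/-- **A crossing of a `J`-curve with a leaf has index `≥ 1`, or `≤ -1`, according to the global
orientation sign of the leaf function** (positivity of intersections
`positivityOfIntersections_leafCoordinate_holds` applied to the leaf coordinate package
`exists_leafCoordinateAt`, transferred to the plain leaf function by
`wind_mul_add_mul_conj_of_norm_lt{,'}` and `leafFunction_sign_const`). [cite: Wendl2018, Thm. 2.49] -/
theorem wind_leafFunction_of_crossing {a : ℂ} (ha : ‖a‖ < ε) {γ : ℂ → X}
    (hγ : ContMDiff 𝓘(ℝ, ℂ) (𝓡 4) ∞ γ) (hJγ : IsJHolomorphic (𝓡 4) (fun y => JX y) γ)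
    (h0 : γ 0 ∈ range (U a) ∪ {V a 0})
    (hnot : ¬ ∀ᶠ s in 𝓝 (0 : ℂ), γ s ∈ range (U a) ∪ {V a 0})
    {p₀ : X} (hp₀ : p₀ ∈ ⋃ a ∈ ball (0 : ℂ) ε, (range (U a) ∪ {V a 0}))
    {v₀ : TangentSpace (𝓡 4) p₀} (hv₀ : mfderiv (𝓡 4) 𝓘(ℝ, ℂ) (leafFunction U V ε) p₀ v₀ ≠ 0) :
    ∃ r₁ : ℝ, 0 < r₁ ∧
      (∀ s : ℂ, 0 < ‖s‖ → ‖s‖ ≤ r₁ →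
        γ s ∈ (⋃ a ∈ ball (0 : ℂ) ε, (range (U a) ∪ {V a 0})) ∧ leafFunction U V ε (γ s) ≠ a) ∧
      ∀ r : ℝ, 0 < r → r ≤ r₁ →
        (0 < ((show ℂ from mfderiv (𝓡 4) 𝓘(ℝ, ℂ) (leafFunction U V ε) p₀ (JX p₀ v₀)) *
            conj (show ℂ from mfderiv (𝓡 4) 𝓘(ℝ, ℂ) (leafFunction U V ε) p₀ v₀)).im →
          1 ≤ wind (fun t => leafFunction U V ε (γ (circleLoop 0 r t)) - a)) ∧
        (¬ 0 < ((show ℂ from mfderiv (𝓡 4) 𝓘(ℝ, ℂ) (leafFunction U V ε) p₀ (JX p₀ v₀)) *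
            conj (show ℂ from mfderiv (𝓡 4) 𝓘(ℝ, ℂ) (leafFunction U V ε) p₀ v₀)).im →
          wind (fun t => leafFunction U V ε (γ (circleLoop 0 r t)) - a) ≤ -1) := by
  dsimp only
  obtain ⟨G, α, β, hG, hGJ, hG0, hGinj, hGr, hne, hlin, hsign, hloc⟩ :=
    exists_leafCoordinateAt hleaf hUs hVs hdisj himm ha h0
  set W : Set X := ⋃ a ∈ ball (0 : ℂ) ε, (range (U a) ∪ {V a 0}) with hWdef
  set A : X → ℂ := leafFunction U V ε with hAdef
  set π' : X → ℂ := fun y => α * (A y - a) + β * conj (A y - a) with hπ'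
  have hW : IsOpen W := isOpen_sweep hleaf hUs hVs himm
  have hγ0W : γ 0 ∈ W := mem_iUnion₂.2 ⟨a, by simpa using ha, h0⟩
  have hA : ContMDiffOn (𝓡 4) 𝓘(ℝ, ℂ) ∞ A W := contMDiffOn_leafFunction hleaf hUs hVs hdisj himm
  have hAd : ∀ x ∈ W, MDifferentiableAt (𝓡 4) 𝓘(ℝ, ℂ) A x := fun x hx =>
    (hA.contMDiffAt (hW.mem_nhds hx)).mdifferentiableAt (by simp)
  have hsurjπ : ∀ x ∈ W, Surjective (mfderiv (𝓡 4) 𝓘(ℝ, ℂ) π' x) := fun x hx =>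
    surjective_mfderiv_postCompose (hAd x hx)
      (surjective_mfderiv_leafFunction hleaf hUs hVs hdisj himm hx) hne a
  have hlin' : ∀ w : TangentSpace (𝓡 4) (G 0),
      (show ℂ from mfderiv (𝓡 4) 𝓘(ℝ, ℂ) π' (G 0) (JX (G 0) w)) =
        Complex.I * (show ℂ from mfderiv (𝓡 4) 𝓘(ℝ, ℂ) π' (G 0) w) := by
    rw [hG0]
    exact hlin
  have hG0W : G 0 ∈ W := by rw [hG0]; exact hγ0W
  have hX := positivityOfIntersections_leafCoordinate_holds X JX γ G W π' hγ hJγ hG hGJ hG0.symm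
    hGinj hW hG0W (contMDiffOn_postCompose hA α β a) hsurjπ hloc hlin'
  rcases hX with hev | ⟨r₁, hr₁, hpunct, hwind, -⟩
  · exfalso
    apply hnot
    filter_upwards [hev] with s ⟨hsW, hs0⟩
    have hsa : A (γ s) = a := (postCompose_eq_zero_iff hne a _).1 hs0
    rw [← leafFunction_levelSet hleaf hdisj ha]
    exact ⟨hsW, hsa⟩
  · refine ⟨r₁, hr₁, fun s hs hs' => ⟨(hpunct s hs hs').1, fun h => (hpunct s hs hs').2 ?_⟩,
      fun r hr hrr => ?_⟩
    · simp only [hπ', h, sub_self, mul_zero, map_zero, add_zero]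
    · -- the loop `g`
      set g : ℝ → ℂ := fun t => A (γ (circleLoop 0 r t)) - a with hg
      have hmemW : ∀ t, γ (circleLoop 0 r t) ∈ W ∧ π' (γ (circleLoop 0 r t)) ≠ 0 := fun t => by
        have hn : ‖circleLoop 0 r t‖ = r := by
          have := norm_circleLoop_sub_center 0 r t
          rwa [sub_zero, abs_of_pos hr] at this
        exact hpunct _ (by rw [hn]; exact hr) (by rw [hn]; exact hrr)
      have hgc : Continuous g := by
        have h1 : Continuous fun t => γ (circleLoop 0 r t) :=
          hγ.continuous.comp (continuous_circleLoop 0 r)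
        exact (hA.continuousOn.comp_continuous h1 fun t => (hmemW t).1).sub continuous_const
      have hgl : IsNonvanishingLoop g := by
        refine ⟨hgc.continuousOn, fun t _ h0 => (hmemW t).2 ?_, ?_⟩
        · have h0' : A (γ (circleLoop 0 r t)) - a = 0 := h0
          simp only [hπ', h0', mul_zero, map_zero, add_zero]
        · simp only [hg, circleLoop_zero_eq]
      have hw1 : 1 ≤ wind (fun t => α * g t + β * conj (g t)) := hwind r hr hrr
      -- the sign transfer to the reference point
      obtain ⟨w, hw⟩ := surjective_mfderiv_leafFunction hleaf hUs hVs hdisj himm hγ0W (1 : ℂ)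
      have hw0 : mfderiv (𝓡 4) 𝓘(ℝ, ℂ) (leafFunction U V ε) (γ 0) w ≠ 0 := fun h0 =>
        one_ne_zero (α := ℂ) (hw.symm.trans h0)
      have hsc := leafFunction_sign_const hε hleaf hUs hVs hdisj himm hp₀ hγ0W hv₀ hw0
      dsimp only at hsc
      obtain ⟨hs1, hs2⟩ := hsign w hw0
      dsimp only at hs1 hs2
      constructor
      · intro hpos
        have hβα : ‖β‖ < ‖α‖ := hs1.2 (hsc.1 hpos)
        rwa [wind_mul_add_mul_conj_of_norm_lt hgl hβα] at hw1
      · intro hneg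
        have hαβ : ‖α‖ < ‖β‖ := by
          rcases lt_or_gt_of_ne hne with h | h
          · exact h
          · exact absurd (hsc.2 (hs1.1 h)) hneg
        rw [wind_mul_add_mul_conj_of_norm_lt' hgl hαβ] at hw1
        omega

include hε hleaf hdisj hUs hVs himm in
/-- **No isolated crossings with a leaf other than the central one** (the counting step of
Wendl 2018, Thm. 2.49 in the proof of Prop. 2.53: `[F] · [leaf] = [S] · [S] = 0`). If a smooth
`JX`-holomorphic two-chart sphere `(u, v)` whose glued map is homotopic to that of the central
leaf `(U 0, V 0)` meets the leaf of parameter `a ≠ 0` at finitely many parameters, then it does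
not meet it at all: the sum of the crossing indices is `c(F_*[ℂℙ¹]) = c((F₀)_*[ℂℙ¹]) = 0`
(`sphere_zeroSetIndex_factorsThroughHomology_of_isClosed`, homotopy invariance, and the central
leaf misses the leaf `a`), while every crossing contributes `≥ 1` (or every crossing `≤ -1`)
by `wind_leafFunction_of_crossing`. [cite: Wendl2018, Thm. 2.49 and Prop. 2.53] -/
theorem not_finite_crossings {a : ℂ} (ha : ‖a‖ < ε) (ha0 : a ≠ 0)
    {u v : ℂ → X} {F F₀ : C(ComplexProjectiveSpace 1, X)}
    (hu : ContMDiff 𝓘(ℝ, ℂ) (𝓡 4) ∞ u) (hv : ContMDiff 𝓘(ℝ, ℂ) (𝓡 4) ∞ v)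
    (huv : ∀ z : ℂ, z ≠ 0 → v z = u z⁻¹) (hJu : IsJHolomorphic (𝓡 4) (fun y => JX y) u)
    (hJv : IsJHolomorphic (𝓡 4) (fun y => JX y) v)
    (hF0 : ∀ p, CoordNeZero 0 p → F p = u (affineCoordComplex 0 p 0))
    (hF1 : ∀ p, CoordNeZero 1 p → F p = v (affineCoordComplex 1 p 0))
    (hF₀0 : ∀ p, CoordNeZero 0 p → F₀ p = U 0 (affineCoordComplex 0 p 0))
    (hF₀1 : ∀ p, CoordNeZero 1 p → F₀ p = V 0 (affineCoordComplex 1 p 0))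
    (hhom : F.Homotopic F₀)
    (hfin : {z : ℂ | u z ∈ range (U a) ∪ {V a 0}}.Finite)
    (hne : {z : ℂ | u z ∈ range (U a) ∪ {V a 0}}.Nonempty) : False := by
  classical
  set L : Set X := range (U a) ∪ {V a 0} with hL
  set S : Set ℂ := {z : ℂ | u z ∈ L} with hS
  set W : Set X := ⋃ a ∈ ball (0 : ℂ) ε, (range (U a) ∪ {V a 0}) with hWdef
  set A : X → ℂ := leafFunction U V ε with hAdef
  set π₀ : X → ℂ := fun y => A y - a with hπ₀
  have hW : IsOpen W := isOpen_sweep hleaf hUs hVs himm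
  have hA : ContMDiffOn (𝓡 4) 𝓘(ℝ, ℂ) ∞ A W := contMDiffOn_leafFunction hleaf hUs hVs hdisj himm
  have hπ₀s : ContMDiffOn (𝓡 4) 𝓘(ℝ, ℂ) ∞ π₀ W := hA.sub contMDiffOn_const
  have hLW : L ⊆ W := fun y hy => mem_iUnion₂.2 ⟨a, by simpa using ha, hy⟩
  obtain ⟨hUa, hVa, hUV, -, -, -, -, -, -⟩ := hleaf a ha
  -- the zero set of `π₀` in `W` is the leaf `L`, compact hence closed
  have hzero : {y : X | y ∈ W ∧ π₀ y = 0} = L := by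
    rw [hL, ← leafFunction_levelSet hleaf hdisj ha]
    ext y
    simp only [mem_setOf_eq, hπ₀, sub_eq_zero, hWdef, hAdef]
  have hLc : IsClosed L := (isCompact_twoChart_range_union hUa.continuous hVa.continuous hUV).isClosed
  have hclosed : IsClosed {y : X | y ∈ W ∧ π₀ y = 0} := by rw [hzero]; exact hLc
  obtain ⟨c, hc⟩ := sphere_zeroSetIndex_factorsThroughHomology_of_isClosed X π₀ W hW hπ₀s hclosed
  -- the crossing sets
  have hZ : {z : ℂ | u z ∈ W ∧ π₀ (u z) = 0} = S := by
    ext z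
    exact Set.ext_iff.1 hzero (u z)
  have h00 : ‖(0 : ℂ)‖ < ε := by simpa using hε
  have hA0 : ∀ z, A (U 0 z) = 0 := fun z => leafFunction_apply_U hleaf hdisj h00 z
  have hAV0 : ∀ w, A (V 0 w) = 0 := fun w => leafFunction_apply_V hleaf hdisj h00 w
  have hZ₀ : {z : ℂ | U 0 z ∈ W ∧ π₀ (U 0 z) = 0} = ∅ := by
    ext z
    simp only [mem_setOf_eq, mem_empty_iff_false, iff_false, not_and, hπ₀, hA0, zero_sub, neg_eq_zero]
    exact fun _ => ha0
  have hZ₀' : {w : ℂ | w = 0 ∧ V 0 w ∈ W ∧ π₀ (V 0 w) = 0} = ∅ := by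
    ext w
    simp only [mem_setOf_eq, mem_empty_iff_false, iff_false, not_and, hπ₀, hAV0, zero_sub, neg_eq_zero]
    exact fun _ _ => ha0
  obtain ⟨hU0s, hV0s, hUV0, -, -, -, -, -, -⟩ := hleaf 0 h00
  obtain ⟨r₀, hr₀, hcF⟩ := hc u v F hu hv huv hF0 hF1 (by rw [hZ]; exact hfin)
  obtain ⟨r₀', hr₀', hcF₀⟩ := hc (U 0) (V 0) F₀ hU0s hV0s hUV0 hF₀0 hF₀1
    (by rw [hZ₀]; exact finite_empty)
  have hmap : singularHomology.map ℤ ℤ F (2 * 1)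
      (ComplexProjectiveSpace.homologicalOrientationInt 1).fundamentalClass =
      singularHomology.map ℤ ℤ F₀ (2 * 1)
      (ComplexProjectiveSpace.homologicalOrientationInt 1).fundamentalClass := by
    rw [singularHomology.map_eq_of_homotopic ℤ ℤ hhom]
  -- a reference point for the orientation sign
  have hp₀ : U 0 0 ∈ W := mem_iUnion₂.2 ⟨0, by simpa using hε, Or.inl ⟨0, rfl⟩⟩
  obtain ⟨v₀, hv₀⟩ := surjective_mfderiv_leafFunction hleaf hUs hVs hdisj himm hp₀ (1 : ℂ)
  have hv₀0 : mfderiv (𝓡 4) 𝓘(ℝ, ℂ) (leafFunction U V ε) (U 0 0) v₀ ≠ 0 := fun h0 =>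
    one_ne_zero (α := ℂ) (hv₀.symm.trans h0)
  -- crossing radii for the `u`-crossings
  have hkey : ∀ z ∈ S, ∃ r₁ : ℝ, 0 < r₁ ∧ ∀ r : ℝ, 0 < r → r ≤ r₁ →
      (0 < ((show ℂ from mfderiv (𝓡 4) 𝓘(ℝ, ℂ) (leafFunction U V ε) (U 0 0) (JX (U 0 0) v₀)) *
          conj (show ℂ from mfderiv (𝓡 4) 𝓘(ℝ, ℂ) (leafFunction U V ε) (U 0 0) v₀)).im →
        1 ≤ wind (fun t => π₀ (u (circleLoop z r t)))) ∧
      (¬ 0 < ((show ℂ from mfderiv (𝓡 4) 𝓘(ℝ, ℂ) (leafFunction U V ε) (U 0 0) (JX (U 0 0) v₀)) *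
          conj (show ℂ from mfderiv (𝓡 4) 𝓘(ℝ, ℂ) (leafFunction U V ε) (U 0 0) v₀)).im →
        wind (fun t => π₀ (u (circleLoop z r t))) ≤ -1) := by
    intro z hz
    have hnot : ¬ ∀ᶠ s in 𝓝 (0 : ℂ), (u ∘ fun s : ℂ => s + z) s ∈ L := by
      intro h
      have h' : ∀ᶠ z' in 𝓝 z, z' ∈ S :=
        (eventually_nhds_add_right_iff (p := fun z' => u z' ∈ L)).1 h
      exact not_eventually_mem_of_finite hfin z h'
    obtain ⟨r₁, hr₁, -, hw⟩ := wind_leafFunction_of_crossing hε hleaf hUs hVs hdisj himm ha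
      (contMDiff_comp_add_right hu z) (hJu.comp_add_right hu z)
      (by show u (0 + z) ∈ L; rw [zero_add]; exact hz) hnot hp₀ hv₀0
    refine ⟨r₁, hr₁, fun r hr hrr => ?_⟩
    have heq : (fun t => leafFunction U V ε ((u ∘ fun s : ℂ => s + z) (circleLoop 0 r t)) - a) =
        fun t => π₀ (u (circleLoop z r t)) := by
      funext t
      simp only [hπ₀, hAdef, Function.comp_apply, circleLoop_zero_add]
    have := hw r hr hrr
    rw [heq] at this
    exact this
  choose! rz hrz hwz using hkey
  -- the `v`-crossing at `0`
  have hkeyv : ∃ r₂ : ℝ, 0 < r₂ ∧ (v 0 ∈ L → ∀ r : ℝ, 0 < r → r ≤ r₂ →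
      (0 < ((show ℂ from mfderiv (𝓡 4) 𝓘(ℝ, ℂ) (leafFunction U V ε) (U 0 0) (JX (U 0 0) v₀)) *
          conj (show ℂ from mfderiv (𝓡 4) 𝓘(ℝ, ℂ) (leafFunction U V ε) (U 0 0) v₀)).im →
        1 ≤ wind (fun t => π₀ (v (circleLoop 0 r t)))) ∧
      (¬ 0 < ((show ℂ from mfderiv (𝓡 4) 𝓘(ℝ, ℂ) (leafFunction U V ε) (U 0 0) (JX (U 0 0) v₀)) *
          conj (show ℂ from mfderiv (𝓡 4) 𝓘(ℝ, ℂ) (leafFunction U V ε) (U 0 0) v₀)).im →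
        wind (fun t => π₀ (v (circleLoop 0 r t))) ≤ -1)) := by
    by_cases hv0 : v 0 ∈ L
    · have hnot : ¬ ∀ᶠ s in 𝓝 (0 : ℂ), v s ∈ L := by
        intro h
        obtain ⟨δ, hδ, hball⟩ := Metric.eventually_nhds_iff_ball.1 h
        -- `u (w⁻¹) ∈ L` for `0 < ‖w‖ < δ`: infinitely many parameters
        apply (Set.infinite_of_injective_forall_mem (s := S) (f := fun n : ℕ => ((2 / δ + n : ℝ) : ℂ))
          (fun m n hmn => by
            have := Complex.ofReal_injective hmn
            exact_mod_cast (add_left_cancel this)) fun n => ?_) hfin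
        have hpos : 0 < 2 / δ + (n : ℝ) := by positivity
        have hne0 : ((2 / δ + n : ℝ) : ℂ) ≠ 0 := by exact_mod_cast hpos.ne'
        have hmem : (((2 / δ + n : ℝ) : ℂ))⁻¹ ∈ ball (0 : ℂ) δ := by
          rw [mem_ball, dist_zero_right, norm_inv, Complex.norm_real, Real.norm_eq_abs,
            abs_of_pos hpos, inv_lt_comm₀ hpos hδ]
          have : δ⁻¹ < 2 / δ := by rw [div_eq_mul_inv]; linarith [inv_pos.2 hδ]
          linarith [Nat.cast_nonneg (α := ℝ) n]
        have := hball _ hmem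
        rw [huv _ (inv_ne_zero hne0), inv_inv] at this
        exact this
      obtain ⟨r₂, hr₂, -, hw⟩ := wind_leafFunction_of_crossing hε hleaf hUs hVs hdisj himm ha hv hJv
        hv0 hnot hp₀ hv₀0
      exact ⟨r₂, hr₂, fun _ => hw⟩
    · exact ⟨1, one_pos, fun h => absurd h hv0⟩
  obtain ⟨r₂, hr₂, hwv⟩ := hkeyv
  -- a common small radius
  set T : Finset ℂ := hfin.toFinset with hT
  have hTne : T.Nonempty := by simpa [hT] using hne
  have hTmem : ∀ z, z ∈ T ↔ z ∈ S := fun z => by simp [hT]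
  set rS : ℝ := T.inf' hTne rz with hrS
  have hrSpos : 0 < rS := (Finset.lt_inf'_iff hTne).2 fun z hz => hrz z ((hTmem z).1 hz)
  have hrSle : ∀ z ∈ S, rS ≤ rz z := fun z hz => Finset.inf'_le _ ((hTmem z).2 hz)
  set r : ℝ := min (min r₀ r₀') (min r₂ rS) with hr
  have hrpos : 0 < r := lt_min (lt_min hr₀ hr₀') (lt_min hr₂ hrSpos)
  have hr1 : r ≤ r₀ := (min_le_left _ _).trans (min_le_left _ _)
  have hr2 : r ≤ r₀' := (min_le_left _ _).trans (min_le_right _ _)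
  have hr3 : r ≤ r₂ := (min_le_right _ _).trans (min_le_left _ _)
  have hr4 : ∀ z ∈ S, r ≤ rz z := fun z hz => ((min_le_right _ _).trans (min_le_right _ _)).trans (hrSle z hz)
  -- the two evaluations of `c`
  have e1 := hcF r hrpos hr1
  have e0 := hcF₀ r hrpos hr2
  rw [hZ₀, hZ₀', finsum_mem_empty, finsum_mem_empty, add_zero, ← hmap, e1, hZ] at e0
  -- `e0 : Σ_S wind + Σ_{v} wind = 0`
  rw [finsum_mem_eq_finite_toFinset_sum _ hfin] at e0
  -- the `v`-term
  have hZv : {w : ℂ | w = 0 ∧ v w ∈ W ∧ π₀ (v w) = 0} = (if v 0 ∈ L then {0} else ∅) := by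
    ext w
    simp only [mem_setOf_eq]
    constructor
    · rintro ⟨rfl, hwW, hw0⟩
      have : v 0 ∈ L := by rw [← hzero]; exact ⟨hwW, hw0⟩
      rw [if_pos this]; rfl
    · intro hw
      split_ifs at hw with h
      · rw [mem_singleton_iff] at hw
        subst hw
        have := (Set.ext_iff.1 hzero (v 0)).2 h
        exact ⟨rfl, this.1, this.2⟩
      · exact absurd hw (notMem_empty _)
  rw [hZv] at e0
  have htot : (∑ z ∈ T, wind (fun t => π₀ (u (circleLoop z r t)))) +
      (∑ᶠ w ∈ (if v 0 ∈ L then ({0} : Set ℂ) else ∅), wind (fun t => π₀ (v (circleLoop w r t)))) = 0 := by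
    rw [hT]
    exact e0
  by_cases hsgn : 0 < ((show ℂ from mfderiv (𝓡 4) 𝓘(ℝ, ℂ) (leafFunction U V ε) (U 0 0) (JX (U 0 0) v₀)) *
      conj (show ℂ from mfderiv (𝓡 4) 𝓘(ℝ, ℂ) (leafFunction U V ε) (U 0 0) v₀)).im
  · -- every term is `≥ 1`
    have hsum : (1 : ℤ) ≤ ∑ z ∈ T, wind (fun t => π₀ (u (circleLoop z r t))) := by
      calc (1 : ℤ) ≤ T.card := by exact_mod_cast Finset.card_pos.2 hTne
        _ = ∑ z ∈ T, (1 : ℤ) := by simp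
        _ ≤ ∑ z ∈ T, wind (fun t => π₀ (u (circleLoop z r t))) :=
          Finset.sum_le_sum fun z hz => ((hwz z ((hTmem z).1 hz)) r hrpos (hr4 z ((hTmem z).1 hz))).1 hsgn
    have hvterm : (0 : ℤ) ≤ ∑ᶠ w ∈ (if v 0 ∈ L then ({0} : Set ℂ) else ∅),
        wind (fun t => π₀ (v (circleLoop w r t))) := by
      split_ifs with h
      · rw [finsum_mem_singleton]
        exact le_trans zero_le_one ((hwv h r hrpos hr3).1 hsgn)
      · rw [finsum_mem_empty]
    dsimp only at hsgn
    omega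
  · have hsum : ∑ z ∈ T, wind (fun t => π₀ (u (circleLoop z r t))) ≤ -1 := by
      calc ∑ z ∈ T, wind (fun t => π₀ (u (circleLoop z r t))) ≤ ∑ z ∈ T, (-1 : ℤ) :=
            Finset.sum_le_sum fun z hz => ((hwz z ((hTmem z).1 hz)) r hrpos (hr4 z ((hTmem z).1 hz))).2 hsgn
        _ = -(T.card : ℤ) := by simp
        _ ≤ -1 := by
          have : (1 : ℤ) ≤ T.card := by exact_mod_cast Finset.card_pos.2 hTne
          omega
    have hvterm : ∑ᶠ w ∈ (if v 0 ∈ L then ({0} : Set ℂ) else ∅),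
        wind (fun t => π₀ (v (circleLoop w r t))) ≤ 0 := by
      split_ifs with h
      · rw [finsum_mem_singleton]
        have := (hwv h r hrpos hr3).2 hsgn
        omega
      · rw [finsum_mem_empty]
    dsimp only at hsgn
    omega

include hε hleaf hdisj hUs hVs himm in
/-- **Uniqueness clause of the Hofer–Lizan–Sikorav local foliation, from the family**
(Wendl 2018, Prop. 2.53 with Thm. 2.49, case `m = [S] · [S] = 0`). Let `(U a, V a)`, `|a| < ε`,
be a smooth family of pairwise disjoint embedded `JX`-holomorphic two-chart spheres sweeping out an
open set by an immersive parametrisation (the conclusion of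
`hls_localFoliation_embeddedSphere_trivialNormal`), with central leaf `(u₀, v₀) = (U 0, V 0)`.
Then every NON-CONSTANT `JX`-holomorphic two-chart sphere `(u, v)` whose glued map
`F : ℂℙ¹ → X` is homotopic to that of the central leaf and which meets the swept set is one of the
leaves: `im (u, v) = im (U a, V a)` for some `|a| < ε`. PROOF (loc. cit.): by unique continuation
(`jHolomorphic_uniqueContinuation_const_holds`, McDuff 1991 Lemma 2.3) and the local
intersection dichotomy, `u` either lies entirely in a leaf it meets — and then has the same image,
`twoChart_range_union_eq_of_forall_mem` — or meets it at finitely many parameters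
(`twoChart_preimage_eq_univ_or_finite`); moving the meeting point off a finite set one may assume
the leaf has parameter `a ≠ 0`, so that it is disjoint from the central leaf, and then finitely
many crossings are impossible: their indices are all `≥ 1` (positivity of intersections) yet sum
to `[F] · [leaf a] = [F₀] · [leaf a] = 0` (`not_finite_crossings`). The non-constancy hypothesis
`hnc` is exactly what the `c₁`-argument of the printed proof supplies for spheres homotopic to an
embedded `J`-sphere; it is kept explicit here.
[cite: Wendl2018, Prop. 2.53 and Thm. 2.49] [cite: McDuff1991LocalBehaviour, Lemma 2.3] -/
theorem hls_uniqueness_of_localFamily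
    {u₀ v₀ : ℂ → X} (hU0 : ∀ z, U 0 z = u₀ z) (hV0 : ∀ w, V 0 w = v₀ w)
    {u v : ℂ → X} {F F₀ : C(ComplexProjectiveSpace 1, X)}
    (hu : ContMDiff 𝓘(ℝ, ℂ) (𝓡 4) ∞ u) (hv : ContMDiff 𝓘(ℝ, ℂ) (𝓡 4) ∞ v)
    (huv : ∀ z : ℂ, z ≠ 0 → v z = u z⁻¹) (hJu : IsJHolomorphic (𝓡 4) (fun y => JX y) u)
    (hJv : IsJHolomorphic (𝓡 4) (fun y => JX y) v)
    (hF0 : ∀ p, CoordNeZero 0 p → F p = u (affineCoordComplex 0 p 0))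
    (hF1 : ∀ p, CoordNeZero 1 p → F p = v (affineCoordComplex 1 p 0))
    (hF₀0 : ∀ p, CoordNeZero 0 p → F₀ p = u₀ (affineCoordComplex 0 p 0))
    (hF₀1 : ∀ p, CoordNeZero 1 p → F₀ p = v₀ (affineCoordComplex 1 p 0))
    (hhom : F.Homotopic F₀)
    (hmeet : ∃ z a, ‖a‖ < ε ∧ u z ∈ range (U a) ∪ {V a 0})
    (hnc : ∃ z, u z ≠ u 0) :
    ∃ a, ‖a‖ < ε ∧ range u ∪ {v 0} = range (U a) ∪ {V a 0} := by
  classical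
  have hUC : jHolomorphic_uniqueContinuation_const := jHolomorphic_uniqueContinuation_const_holds
  have hF₀0' : ∀ p, CoordNeZero 0 p → F₀ p = U 0 (affineCoordComplex 0 p 0) := fun p hp => by
    rw [hU0]; exact hF₀0 p hp
  have hF₀1' : ∀ p, CoordNeZero 1 p → F₀ p = V 0 (affineCoordComplex 1 p 0) := fun p hp => by
    rw [hV0]; exact hF₀1 p hp
  -- a leaf entirely containing `u` has the same image as `(u, v)`
  have whole : ∀ a, ‖a‖ < ε → {z : ℂ | u z ∈ range (U a) ∪ {V a 0}} = univ →
      ∃ a, ‖a‖ < ε ∧ range u ∪ {v 0} = range (U a) ∪ {V a 0} := by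
    intro a ha h
    obtain ⟨hUa, hVa, hUVa, hJUa, hJVa, hinja, himma, himm0a, hnota⟩ := hleaf a ha
    refine ⟨a, ha, twoChart_range_union_eq_of_forall_mem hUC JX hUa hVa hUVa hJUa hJVa hinja himma
      himm0a hnota hu hv huv hJu hJv (fun w => ?_) hnc⟩
    have hw : w ∈ {z : ℂ | u z ∈ range (U a) ∪ {V a 0}} := by rw [h]; exact mem_univ w
    exact hw
  -- a leaf of nonzero parameter met by `u` contains `u`
  have main : ∀ a, ‖a‖ < ε → a ≠ 0 → ∀ z, u z ∈ range (U a) ∪ {V a 0} →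
      ∃ a, ‖a‖ < ε ∧ range u ∪ {v 0} = range (U a) ∪ {V a 0} := by
    intro a ha ha0 z hz
    obtain ⟨hUa, hVa, hUVa, hJUa, hJVa, hinja, himma, himm0a, hnota⟩ := hleaf a ha
    rcases twoChart_preimage_eq_univ_or_finite JX hUa hVa hUVa hJUa hJVa hinja himma himm0a hnota
      hu hv huv hJu hJv with h | h
    · exact whole a ha h
    · exact (not_finite_crossings hε hleaf hUs hVs hdisj himm ha ha0 hu hv huv hJu hJv hF0 hF1
        hF₀0' hF₀1' hhom h ⟨z, hz⟩).elim
  obtain ⟨z₁, a₁, ha₁, hz₁⟩ := hmeet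
  rcases ne_or_eq a₁ 0 with ha₁0 | rfl
  · exact main a₁ ha₁ ha₁0 z₁ hz₁
  obtain ⟨hUa, hVa, hUVa, hJUa, hJVa, hinja, himma, himm0a, hnota⟩ := hleaf 0 ha₁
  rcases twoChart_preimage_eq_univ_or_finite JX hUa hVa hUVa hJUa hJVa hinja himma himm0a hnota
    hu hv huv hJu hJv with h | h
  · exact whole 0 ha₁ h
  · -- finitely many crossings with the central leaf: move to a nearby point of the sweep
    have hW : IsOpen (⋃ a ∈ ball (0 : ℂ) ε, (range (U a) ∪ {V a 0})) :=
      isOpen_sweep hleaf hUs hVs himm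
    have hz₁W : u z₁ ∈ ⋃ a ∈ ball (0 : ℂ) ε, (range (U a) ∪ {V a 0}) :=
      mem_iUnion₂.2 ⟨0, mem_ball_self hε, hz₁⟩
    have hev : ∀ᶠ z in 𝓝 z₁, u z ∈ ⋃ a ∈ ball (0 : ℂ) ε, (range (U a) ∪ {V a 0}) :=
      hu.continuous.continuousAt.eventually_mem (hW.mem_nhds hz₁W)
    obtain ⟨z₂, hz₂W, hz₂S⟩ : ∃ z₂, u z₂ ∈ (⋃ a ∈ ball (0 : ℂ) ε, (range (U a) ∪ {V a 0})) ∧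
        z₂ ∉ {z : ℂ | u z ∈ range (U 0) ∪ {V 0 0}} := by
      by_contra hcon
      refine not_eventually_mem_of_finite h z₁ (hev.mono fun z hz => ?_)
      by_contra hzS
      exact hcon ⟨z, hz, hzS⟩
    obtain ⟨ha₂, hmem⟩ := mem_leaf_leafFunction hleaf hdisj hz₂W
    have ha₂0 : leafFunction U V ε (u z₂) ≠ 0 := by
      intro h0
      rw [h0] at hmem
      exact hz₂S hmem
    exact main _ ha₂ ha₂0 z₂ hmem

end Assembly

end Literature.Geometry.Symplectic

end
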